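import Summits.CriticalPhenomena.Ising3DConformalLimit.Theorems.InverseSquareTelemetryPositiveSolutionAsymptoticsFinal
import Literature.Probability.LatticeModels.LatticeLaplacianZd
import HarnessLib

/-!
# Route SynchronousCoupling · crux `UniformRegularity` (stmt-CriticalPhenomena-4658) ·
# line `SketchIdeator2` (card B, bounded-telemetry-harnack) · stub `stub_axisHarnack`

THEOREM-ONLY file (`--supports stmt-CriticalPhenomena-4658`): the analytic half of card B, a
**scale-invariant Harnack comparison along the axis** for globally positive solutions `u` of the
lattice Schrödinger equation `Δu = V·u` on `ℤ³` (`Δ = latticeLaplacianZd`, the six-neighbour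
Laplacian) whose potential obeys `|x|₂² |V(x)| ≤ C` on the fat annulus `{n/4 ≤ |x|₂ ≤ 8n}`:
`u(n e₀) ≤ K(C) · u(2n e₀)` uniformly in `n ≥ 1`.

## Proof

* **Large `n` (Harnack chain).** Let `c₀, C_H, R₀` be the data of the landed Schrödinger–Harnack
  inequality on remote balls `schrodingerHarnack` (crux 4496, `…PositiveSolutionAsymptoticsFinal`),
  and `0 < θ ≤ 1/8` with `64 C θ² ≤ c₀` (`ballAssembly_exists_theta` with `κ = 0`). Put `r = 2n`,
  so that `x = n e₀` and `y = 2n e₀` lie in the shell `{r/2 ≤ |·|₂ ≤ r}`; the landed lattice chain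
  `stub_annulusChain` (step ratio `θ/16`) joins them by `N = N(θ)` points `z j` of
  `{r/4 ≤ |·|₂ ≤ 2r}` with steps `≤ θ r/16`. The Harnack balls `B(z j, θ r)` lie in
  `{r/8 ≤ |·|₂ ≤ 4r} = {n/4 ≤ |·|₂ ≤ 8n}` (`θ r ≤ r/8`), where the equation holds and
  `|V| ≤ 64 C/r² ≤ c₀/(θ r)²`; `z (j+1)` lies in the core `B(z j, θ r/16)`, and `u ≥ 0` globally.
  Hence `u(z j) ≤ C_H u(z (j+1))` once `θ r ≥ R₀` and `r ≥ r₀`, and `u(n e₀) ≤ C_H^N u(2n e₀)`.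
* **Small `n`.** At `z = (k+1) e₀`, `n ≤ k+1 ≤ 2n` (inside the annulus), the equation reads
  `Σ_{nbrs} u = (6 + V z) u z`; all terms are positive and `|V z| ≤ C/|z|₂² ≤ C`, so
  `u(k e₀) ≤ (6 + C) u((k+1) e₀)`; iterating, `u(n e₀) ≤ (6 + C)^n u(2n e₀) ≤ (6+C)^{n₀} u(2n e₀)`.
* `K := C_H^N · (6 + C)^{n₀}` with `n₀ ≥ max r₀ (R₀/θ)`.

References: Delmotte 1999 Thm 1.7; Barlow 2017 Thm 7.19; Gilbarg–Trudinger Thm 8.20 (Harnack chains);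
the lattice inputs are the tree's `schrodingerHarnack` and `stub_annulusChain`. [folklore]
-/

noncomputable section

namespace Summit.CriticalPhenomena.Ising3DConformalLimit.Theorems.TelemetryHarnack

open scoped BigOperators
open Literature.Probability.LatticeModels
open Summit.CriticalPhenomena.Ising3DConformalLimit.Theorems.PositiveSolutionAsymptotics
  (schrodingerHarnack stub_annulusChain ballAssembly_exists_theta)
open Summit.CriticalPhenomena.Ising3DConformalLimit.Theorems.PositiveSolutionAsymptotics.Assembly
  (sqrt_sumSq_le_add_sub')

/-! ### Small lemmas -/

/-- The Euclidean norm of the axis point `m e₀` (`m : ℕ`) is `m`. [folklore] -/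
theorem sqrt_sumSq_axis (m : ℕ) :
    Real.sqrt (∑ i, (((Pi.single (0 : Fin 3) (m : ℤ) : Site 3) i : ℝ)) ^ 2) = m := by
  have h : (∑ i, (((Pi.single (0 : Fin 3) (m : ℤ) : Site 3) i : ℝ)) ^ 2) = (m : ℝ) ^ 2 := by
    simp [Pi.single_apply]
  rw [h, Real.sqrt_sq (Nat.cast_nonneg m)]

/-- The squared Euclidean norm of the axis point `m e₀` (`m : ℕ`) is `m²`. [folklore] -/
theorem sumSq_axis (m : ℕ) :
    (∑ i, (((Pi.single (0 : Fin 3) (m : ℤ) : Site 3) i : ℝ)) ^ 2) = (m : ℝ) ^ 2 := by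
  simp [Pi.single_apply]

/-- **One step of the equation along the axis.** If `u > 0` everywhere, `Δu(z) = V(z) u(z)` and
`|V z| ≤ C`, then `u(z - e₀) ≤ (6 + C) u(z)`: indeed `Σ_{nbrs} u = (6 + V z) u z` and all the
neighbour terms are positive. [folklore] -/
theorem axis_step {u V : Site 3 → ℝ} {C : ℝ} {z : Site 3} (hpos : ∀ x, 0 < u x)
    (heq : latticeLaplacianZd u z = V z * u z) (hV : |V z| ≤ C) :
    u (z - Pi.single 0 1) ≤ (6 + C) * u z := by
  rw [latticeLaplacianZd_three, Fin.sum_univ_three] at heq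
  have h0 := hpos (z + Pi.single 0 1)
  have h1 := hpos (z + Pi.single 1 1)
  have h1' := hpos (z - Pi.single 1 1)
  have h2 := hpos (z + Pi.single 2 1)
  have h2' := hpos (z - Pi.single 2 1)
  have hz := hpos z
  have hVle : V z ≤ C := (le_abs_self _).trans hV
  nlinarith [mul_le_mul_of_nonneg_right hVle hz.le]

/-- **Small scales.** Iterating `axis_step` from `2n e₀` down to `n e₀` (all the points
`(k+1) e₀`, `n ≤ k+1 ≤ 2n`, lie in the annulus `{n/4 ≤ |·|₂ ≤ 8n}`, where `|V| ≤ C/|z|₂² ≤ C`)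
gives `u(n e₀) ≤ (6 + C)^n u(2n e₀)`. [folklore] -/
theorem axis_iterate {u V : Site 3 → ℝ} {C : ℝ} {n : ℕ} (hn : 1 ≤ n) (hpos : ∀ x, 0 < u x)
    (hyp : ∀ x : Site 3, (n : ℝ) / 4 ≤ Real.sqrt (∑ i, ((x i : ℝ)) ^ 2) →
      Real.sqrt (∑ i, ((x i : ℝ)) ^ 2) ≤ 8 * n →
        latticeLaplacianZd u x = V x * u x ∧ (∑ i, ((x i : ℝ)) ^ 2) * |V x| ≤ C) :
    u (Pi.single 0 (n : ℤ)) ≤ (6 + C) ^ n * u (Pi.single 0 (2 * (n : ℤ))) := by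
  have hn1 : (1 : ℝ) ≤ n := by exact_mod_cast hn
  have key : ∀ m : ℕ, m ≤ n → ∀ k : ℕ, k + m = 2 * n →
      u (Pi.single 0 (k : ℤ)) ≤ (6 + C) ^ m * u (Pi.single 0 (2 * (n : ℤ))) := by
    intro m
    induction m with
    | zero =>
      intro _ k hk
      obtain rfl : k = 2 * n := by omega
      push_cast
      simp
    | succ m ih =>
      intro hm k hk
      have ih' := ih (Nat.le_of_succ_le hm) (k + 1) (by omega)
      -- the point `z = (k+1) e₀` lies in the annulus
      have hk1 : (n : ℝ) ≤ ((k + 1 : ℕ) : ℝ) := by exact_mod_cast (show n ≤ k + 1 by omega)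
      have hk2 : ((k + 1 : ℕ) : ℝ) ≤ 2 * n := by exact_mod_cast (show k + 1 ≤ 2 * n by omega)
      have hnorm := sqrt_sumSq_axis (k + 1)
      obtain ⟨heq, hV⟩ := hyp (Pi.single 0 ((k + 1 : ℕ) : ℤ)) (by rw [hnorm]; linarith)
        (by rw [hnorm]; linarith)
      -- `|V z| ≤ C` since `|z|₂² = (k+1)² ≥ 1`
      rw [sumSq_axis (k + 1)] at hV
      have h0 := abs_nonneg (V (Pi.single 0 ((k + 1 : ℕ) : ℤ)))
      have hVC : |V (Pi.single 0 ((k + 1 : ℕ) : ℤ))| ≤ C := by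
        have h1 : (1 : ℝ) ≤ ((k + 1 : ℕ) : ℝ) ^ 2 := by nlinarith
        nlinarith [mul_le_mul_of_nonneg_right h1 h0]
      have hC0 : 0 ≤ C := h0.trans hVC
      have hst := axis_step hpos heq hVC
      have e : (Pi.single 0 ((k + 1 : ℕ) : ℤ) : Site 3) - Pi.single 0 1 = Pi.single 0 (k : ℤ) := by
        rw [← Pi.single_sub, Nat.cast_succ, add_sub_cancel_right]
      rw [e] at hst
      calc u (Pi.single 0 (k : ℤ)) ≤ (6 + C) * u (Pi.single 0 ((k + 1 : ℕ) : ℤ)) := hst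
        _ ≤ (6 + C) * ((6 + C) ^ m * u (Pi.single 0 (2 * (n : ℤ)))) :=
            mul_le_mul_of_nonneg_left ih' (by linarith)
        _ = (6 + C) ^ (m + 1) * u (Pi.single 0 (2 * (n : ℤ))) := by rw [pow_succ]; ring
  exact key n le_rfl n (by ring)

/-- **The Harnack balls stay in the fat annulus.** If `r/4 ≤ |z_c|₂ ≤ 2r` and `|z - z_c|₂ ≤ ρ ≤ r/8`,
then `r/8 ≤ |z|₂ ≤ 4r` (triangle inequality in `ℝ³`). [folklore] -/
theorem ball_mem_annulus {r ρ : ℝ} {zc z : Site 3} (hρ : ρ ≤ r / 8)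
    (hzlo : r / 4 ≤ Real.sqrt (∑ i, ((zc i : ℝ)) ^ 2))
    (hzhi : Real.sqrt (∑ i, ((zc i : ℝ)) ^ 2) ≤ 2 * r)
    (hd : Real.sqrt (∑ i, (((z i : ℤ) : ℝ) - ((zc i : ℤ) : ℝ)) ^ 2) ≤ ρ) :
    r / 8 ≤ Real.sqrt (∑ i, ((z i : ℝ)) ^ 2) ∧ Real.sqrt (∑ i, ((z i : ℝ)) ^ 2) ≤ 4 * r := by
  have h1 := Literature.Geometry.Lorentzian.sqrt_sum_sq_le_add (fun i => ((z i : ℤ) : ℝ))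
    (fun i => ((zc i : ℤ) : ℝ))
  have h2 := sqrt_sumSq_le_add_sub' (fun i => ((z i : ℤ) : ℝ)) (fun i => ((zc i : ℤ) : ℝ))
  have hρ0 : 0 ≤ ρ := (Real.sqrt_nonneg _).trans hd
  constructor <;> linarith

/-- **Smallness of the potential on the Harnack balls.** `|z|₂ ≥ r/8`, `|z|₂² |V z| ≤ C` and
`64 C θ² ≤ c₀` give `|V z| ≤ c₀/(θ r)²`. [folklore] -/
theorem potential_small {s Vz C c₀ θ r : ℝ} (hr : 0 < r) (hθ : 0 < θ) (hs : r / 8 ≤ Real.sqrt s)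
    (hV : s * |Vz| ≤ C) (hθc : 64 * C * θ ^ 2 ≤ c₀) : |Vz| ≤ c₀ / (θ * r) ^ 2 := by
  have hs' : (r / 8) ^ 2 ≤ s := (Real.le_sqrt' (by positivity)).1 hs
  have hV0 := abs_nonneg Vz
  have h1 : r ^ 2 * |Vz| ≤ 64 * C := by nlinarith [mul_le_mul_of_nonneg_right hs' hV0]
  rw [le_div_iff₀ (by positivity)]
  calc |Vz| * (θ * r) ^ 2 = θ ^ 2 * (r ^ 2 * |Vz|) := by ring
    _ ≤ θ ^ 2 * (64 * C) := mul_le_mul_of_nonneg_left h1 (sq_nonneg θ)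
    _ = 64 * C * θ ^ 2 := by ring
    _ ≤ c₀ := hθc

/-! ### The registered stub -/

/-- **Stub `stub_axisHarnack` of line `SketchIdeator2` (card B) of crux `UniformRegularity`
(stmt-CriticalPhenomena-4658).** Scale-invariant Harnack comparison along the axis for globally
positive solutions of the lattice Schrödinger equation `Δu = V·u` on `ℤ³` with `|x|₂²|V(x)| ≤ C` on the
fat annulus `{n/4 ≤ |x|₂ ≤ 8n}`: `u(n e₀) ≤ K(C)·u(2n e₀)` for all `n ≥ 1`. Large `n`: Harnack chain of
`N(θ)` remote balls of radius `2θn` (landed `schrodingerHarnack`, `stub_annulusChain`); small `n`: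
`n` one-step comparisons `u(k e₀) ≤ (6 + C) u((k+1) e₀)`. [Delmotte1999 Thm 1.7; Barlow2017 Thm 7.19;
GilbargTrudinger Thm 8.20] -/
theorem stub_axisHarnack : ∀ C : ℝ, 0 < C → ∃ K : ℝ, 0 < K ∧
    ∀ (u V : Literature.Probability.LatticeModels.Site 3 → ℝ) (n : ℕ), 1 ≤ n →
      (∀ x : Literature.Probability.LatticeModels.Site 3, 0 < u x) →
      (∀ x : Literature.Probability.LatticeModels.Site 3,
          (n : ℝ) / 4 ≤ Real.sqrt (∑ i, ((x i : ℝ)) ^ 2) → Real.sqrt (∑ i, ((x i : ℝ)) ^ 2) ≤ 8 * n →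
            Literature.Probability.LatticeModels.latticeLaplacianZd u x = V x * u x ∧
              (∑ i, ((x i : ℝ)) ^ 2) * |V x| ≤ C) →
      u (Pi.single 0 (n : ℤ)) ≤ K * u (Pi.single 0 (2 * (n : ℤ))) := by
  intro C hC
  -- the Harnack data, the ball ratio `θ`, the chain data and the threshold `n₀`
  obtain ⟨c₀, hc₀, CH, hCH, R₀, hHar⟩ := schrodingerHarnack
  obtain ⟨θ, hθ, hθ8, hθc⟩ := ballAssembly_exists_theta C (le_refl (0 : ℝ)) hc₀
  have hθc' : 64 * C * θ ^ 2 ≤ c₀ := by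
    have hmax := le_max_left C 0
    nlinarith [mul_le_mul_of_nonneg_left hmax (sq_nonneg θ),
      mul_nonneg (sq_nonneg θ) (le_max_right C 0)]
  obtain ⟨N, r₀, hchain⟩ := stub_annulusChain (θ / 16) (by positivity)
  obtain ⟨n₀, hn₀⟩ := exists_nat_ge (max r₀ (R₀ / θ))
  have hCHpos : 0 < CH := by linarith
  have h6C : 1 ≤ 6 + C := by linarith
  refine ⟨CH ^ N * (6 + C) ^ n₀, by positivity, ?_⟩
  intro u V n hn hpos hyp
  have hn1 : (1 : ℝ) ≤ n := by exact_mod_cast hn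
  have hupos := hpos (Pi.single 0 (2 * (n : ℤ)))
  by_cases hlarge : max r₀ (R₀ / θ) ≤ 2 * (n : ℝ)
  · -- **large scales: the Harnack chain**
    have hr₀ : r₀ ≤ 2 * (n : ℝ) := le_trans (le_max_left _ _) hlarge
    have hR₀ : R₀ ≤ θ * (2 * (n : ℝ)) := by
      have h1 : R₀ / θ ≤ 2 * (n : ℝ) := le_trans (le_max_right _ _) hlarge
      rwa [div_le_iff₀ hθ, mul_comm] at h1
    have hr0 : (0 : ℝ) < 2 * n := by linarith
    have hθr : 0 ≤ θ * (2 * (n : ℝ)) := by positivity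
    have hρ : θ * (2 * (n : ℝ)) ≤ 2 * (n : ℝ) / 8 := by nlinarith
    -- the chain from `n e₀` to `2n e₀`
    have hx := sqrt_sumSq_axis n
    have hy : Real.sqrt (∑ i, (((Pi.single (0 : Fin 3) (2 * (n : ℤ)) : Site 3) i : ℝ)) ^ 2) = 2 * n := by
      have h := sqrt_sumSq_axis (2 * n)
      push_cast at h
      exact h
    obtain ⟨z, hz0, hzN, hzin, hzstep⟩ := hchain (2 * n) hr₀ (Pi.single 0 (n : ℤ))
      (Pi.single 0 (2 * (n : ℤ))) (by rw [hx]; linarith) (by rw [hx]; linarith) (by rw [hy]; linarith)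
      (by rw [hy])
    -- one Harnack step along the chain
    have hstep : ∀ j : ℕ, j < N → u (z j) ≤ CH * u (z (j + 1)) := by
      intro j hj
      obtain ⟨hzjlo, hzjhi⟩ := hzin j hj.le
      -- the ball `B(z j, 2θn)` lies in the annulus `{n/4 ≤ |·|₂ ≤ 8n}`
      have hreg : ∀ w : Site 3,
          Real.sqrt (∑ i, (((w i : ℤ) : ℝ) - ((z j i : ℤ) : ℝ)) ^ 2) ≤ θ * (2 * (n : ℝ)) →
            (n : ℝ) / 4 ≤ Real.sqrt (∑ i, ((w i : ℝ)) ^ 2) ∧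
              Real.sqrt (∑ i, ((w i : ℝ)) ^ 2) ≤ 8 * n := by
        intro w hw
        obtain ⟨h1, h2⟩ := ball_mem_annulus hρ hzjlo hzjhi hw
        constructor <;> linarith
      refine hHar (θ * (2 * (n : ℝ))) hR₀ (z j) V u ?_ (fun w _ => (hpos w).le) ?_ (z j) (z (j + 1))
        ?_ ?_
      · intro w hw
        obtain ⟨h1, h2⟩ := hreg w hw
        exact potential_small hr0 hθ (by linarith) (hyp w h1 h2).2 hθc'
      · intro w hw
        obtain ⟨h1, h2⟩ := hreg w hw
        exact (hyp w h1 h2).1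
      · rw [show (∑ i, (((z j i : ℤ) : ℝ) - ((z j i : ℤ) : ℝ)) ^ 2) = 0 by simp, Real.sqrt_zero]
        positivity
      · have h1 := hzstep j hj
        have e : θ / 16 * (2 * (n : ℝ)) = θ * (2 * (n : ℝ)) / 16 := by ring
        rwa [e] at h1
    -- iterate
    have hind : ∀ j : ℕ, j ≤ N → u (z 0) ≤ CH ^ j * u (z j) := by
      intro j
      induction j with
      | zero => intro _; simp
      | succ j ih =>
        intro hj
        have h1 := ih (Nat.le_of_succ_le hj)
        have h2 := hstep j (Nat.lt_of_succ_le hj)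
        have hCj : 0 ≤ CH ^ j := pow_nonneg hCHpos.le j
        calc u (z 0) ≤ CH ^ j * u (z j) := h1
          _ ≤ CH ^ j * (CH * u (z (j + 1))) := mul_le_mul_of_nonneg_left h2 hCj
          _ = CH ^ (j + 1) * u (z (j + 1)) := by rw [pow_succ]; ring
    have hA := hind N le_rfl
    rw [hz0, hzN] at hA
    calc u (Pi.single 0 (n : ℤ)) ≤ CH ^ N * u (Pi.single 0 (2 * (n : ℤ))) := hA
      _ ≤ CH ^ N * u (Pi.single 0 (2 * (n : ℤ))) * (6 + C) ^ n₀ :=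
          le_mul_of_one_le_right (by positivity) (one_le_pow₀ h6C)
      _ = CH ^ N * (6 + C) ^ n₀ * u (Pi.single 0 (2 * (n : ℤ))) := by ring
  · -- **small scales: one-step comparisons**
    rw [not_le] at hlarge
    have hnn₀ : n ≤ n₀ := by
      have h1 : (n : ℝ) < n₀ := by linarith
      exact_mod_cast h1.le
    have hB := axis_iterate hn hpos hyp
    calc u (Pi.single 0 (n : ℤ)) ≤ (6 + C) ^ n * u (Pi.single 0 (2 * (n : ℤ))) := hB
      _ ≤ (6 + C) ^ n₀ * u (Pi.single 0 (2 * (n : ℤ))) :=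
          mul_le_mul_of_nonneg_right (pow_le_pow_right₀ h6C hnn₀) hupos.le
      _ ≤ CH ^ N * ((6 + C) ^ n₀ * u (Pi.single 0 (2 * (n : ℤ)))) :=
          le_mul_of_one_le_left (by positivity) (one_le_pow₀ hCH)
      _ = CH ^ N * (6 + C) ^ n₀ * u (Pi.single 0 (2 * (n : ℤ))) := by ring

end Summit.CriticalPhenomena.Ising3DConformalLimit.Theorems.TelemetryHarnack
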